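import Mathlib

/-!
# Refinement paths and their switching graphs — definitions for the BranchSum theorem

Route `PneNP/SymmetryBudget`, dichotomy `NoHiddenOrder` (stmt-PneNP-14781) / `WindowBarrier`
(stmt-PneNP-2145).  The positive side of the dichotomy rests on a symmetric ("flat") compilation of the
Corneil–Goldberg exponential canonisation of the `⌊log₂ m⌋`-window; the size of that compilation is
governed by the BRANCH SUM `Σ_k |A_k|` of the individualised cells along a root–leaf path of the
recursion tree (memo `CG84-FLATNESS.md`, evidence on both items, §7–§9).  Theorem 9.1 of the memo
bounds the branch sum by `O(g log g)`; its proof uses only five properties of the path, isolated here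
as the structure `RefinementPath` (H1–H5 of §9.3):

* `cellOf W c u` — the cell (colour fibre) of `u` inside the vertex set `W` for a colouring `c`;
* `blockEdges`, `SwComp`, `swGraph` — the SWITCHING-EQUIVALENT GRAPH of a partition (B. Laubner,
  *The structure of graphs and new logics for the characterization of Polynomial Time*, PhD thesis,
  HU Berlin 2011, Def. 3.3.2; after D. G. Corneil, M. Goldberg, *A non-factorial algorithm for
  canonical numbering of a graph*, J. Algorithms 5 (1984)): complement every block of density `> 1/2`;
* `RefinementPath G N` — vertex sets `W k`, colourings `col k`, branching numbers `d k` with: nesting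
  of vertex sets and cells (H1), equitability (H2), connectivity of the switching graph in cut form
  (H3), homogeneity of removed vertices towards later cells (H4: Laubner Def. 3.3.1 for the sections
  taken, resp. equitability w.r.t. the individualised singleton), and strict progress (H5);
* bookkeeping predicates of the proof: `Event` (removed or halved), `delta` (progress `Δ_k`), `Bad`
  (quiet step `2Δ_k < d_k`), `HubSpec` (hub data of a bad step), `Stale`.

The theorems are in `SymmetryBudgetNoHiddenOrderBranchSumPotential.lean` (Fact S, the potential
argument), `SymmetryBudgetNoHiddenOrderBranchSumHub.lean` (structure of a bad step: giants, hub, type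
bound, exhaustion) and `SymmetryBudgetNoHiddenOrderBranchSum.lean` (fresh/stale chains and the bound
`Σ_{k<N} d k ≤ 6·|V|·Nat.log 2 |V|`).  Deliberately NOT here: the CG84 process itself (refinement,
sections, the recursion tree) and the verification that its paths satisfy H1–H5 — a separate
technology item — and anything about circuits.
-/

namespace Summit.PneNP.PneNP.Theorems

open Finset

namespace BranchSum

variable {V : Type*}


/-- The cell of `u` for the colouring `c` inside the vertex set `W`: the fibre of `c` through `u`. -/
def cellOf (W : Finset V) (c : V → ℕ) (u : V) : Finset V := W.filter fun v => c v = c u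

/-- Membership in a cell. -/
theorem mem_cellOf_iff {W : Finset V} {c : V → ℕ} {u v : V} : v ∈ cellOf W c u ↔ v ∈ W ∧ c v = c u := by
  simp [cellOf]

/-- Vertices of equal colour have equal cells. -/
theorem cellOf_eq_of_col_eq {W : Finset V} {c : V → ℕ} {u v : V} (h : c v = c u) :
    cellOf W c v = cellOf W c u := by
  ext w; simp only [mem_cellOf_iff, h]

/-- A cell is the cell of each of its members. -/
theorem cellOf_eq_of_mem {W : Finset V} {c : V → ℕ} {u v : V} (hv : v ∈ cellOf W c u) :
    cellOf W c v = cellOf W c u :=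
  cellOf_eq_of_col_eq (mem_cellOf_iff.1 hv).2

variable (G : SimpleGraph V) [DecidableRel G.Adj]

/-- Number of ordered `G`-edges from the cell of `u` to the cell of `v`. -/
def blockEdges (W : Finset V) (c : V → ℕ) (u v : V) : ℕ :=
  ((cellOf W c u ×ˢ cellOf W c v).filter fun p => G.Adj p.1 p.2).card

/-- The block between the cells of `u` and `v` is COMPLEMENTED in the switching-equivalent graph
(Laubner 2011, Def. 3.3.2): its edge density exceeds `1/2`. -/
def SwComp (W : Finset V) (c : V → ℕ) (u v : V) : Prop :=
  (cellOf W c u).card * (cellOf W c v).card < 2 * blockEdges G W c u v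

/-- `SwComp` is decidable. -/
instance (W : Finset V) (c : V → ℕ) : DecidableRel (SwComp G W c) := fun u v => by
  unfold SwComp; infer_instance

/-- `blockEdges` is symmetric. -/
theorem blockEdges_comm (W : Finset V) (c : V → ℕ) (u v : V) :
    blockEdges G W c u v = blockEdges G W c v u := by
  unfold blockEdges
  rw [← Finset.card_map (Equiv.prodComm V V).toEmbedding]
  congr 1
  ext ⟨a, b⟩
  simp only [mem_map_equiv, Equiv.prodComm_symm, Equiv.prodComm_apply, Prod.swap_prod_mk, mem_filter,
    mem_product, G.adj_comm]
  tauto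

/-- `SwComp` is symmetric. -/
theorem swComp_comm (W : Finset V) (c : V → ℕ) (u v : V) : SwComp G W c u v ↔ SwComp G W c v u := by
  unfold SwComp; rw [blockEdges_comm, Nat.mul_comm]

/-- `SwComp` depends only on the colours of its arguments. -/
theorem swComp_congr {W : Finset V} {c : V → ℕ} {u u' v v' : V} (hu : c u' = c u) (hv : c v' = c v) :
    SwComp G W c u' v' ↔ SwComp G W c u v := by
  unfold SwComp blockEdges
  rw [cellOf_eq_of_col_eq hu, cellOf_eq_of_col_eq hv]

/-- The SWITCHING-EQUIVALENT GRAPH `G_P` of the partition `(W, c)` (Laubner 2011, Def. 3.3.2):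
complement every block of density `> 1/2`, keep the others. -/
def swGraph (W : Finset V) (c : V → ℕ) : SimpleGraph V where
  Adj u v := u ≠ v ∧ (SwComp G W c u v ↔ ¬ G.Adj u v)
  symm := ⟨fun u v h => ⟨h.1.symm, by rw [swComp_comm, G.adj_comm]; exact h.2⟩⟩
  loopless := ⟨fun u h => h.1 rfl⟩

/-- Unfolding lemma for adjacency in the switching-equivalent graph. -/
theorem swGraph_adj {W : Finset V} {c : V → ℕ} {u v : V} :
    (swGraph G W c).Adj u v ↔ u ≠ v ∧ (SwComp G W c u v ↔ ¬ G.Adj u v) := Iff.rfl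

variable [DecidableEq V]

/-- Adjacency in the switching-equivalent graph is decidable. -/
instance (W : Finset V) (c : V → ℕ) : DecidableRel (swGraph G W c).Adj := fun u v => by
  unfold swGraph; dsimp only; infer_instance

/-- A REFINEMENT PATH of length `N` for `G`: vertex sets `W k`, colourings `col k`, numbers `d k`,
with hypotheses H1–H5 of CG84-FLATNESS §9.3. -/
structure RefinementPath (N : ℕ) where
  /-- vertex set at node `k` -/
  W : ℕ → Finset V
  /-- colouring at node `k`; its fibres inside `W k` are the cells -/
  col : ℕ → V → ℕ
  /-- the branching number at node `k` (in CG84: the size of the individualised cell) -/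
  d : ℕ → ℕ
  /-- H1a: vertex sets shrink -/
  nest : ∀ k, W (k + 1) ⊆ W k
  /-- after the last node nothing is left -/
  final : W N = ∅
  /-- H1b: cells at node `k+1` lie inside cells at node `k` -/
  colNest : ∀ k, ∀ u ∈ W (k + 1), ∀ v ∈ W (k + 1), col (k + 1) u = col (k + 1) v → col k u = col k v
  /-- cells have at least two elements -/
  two_le : ∀ k, ∀ u ∈ W k, 2 ≤ (cellOf (W k) (col k) u).card
  /-- `d k` is at most every cell size at node `k` -/
  d_le : ∀ k, ∀ u ∈ W k, d k ≤ (cellOf (W k) (col k) u).card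
  /-- H2: the partition is equitable for `G` -/
  equitable : ∀ k, ∀ u ∈ W k, ∀ v ∈ W k, col k u = col k v → ∀ w ∈ W k,
    ((cellOf (W k) (col k) w).filter fun y => G.Adj u y).card =
      ((cellOf (W k) (col k) w).filter fun y => G.Adj v y).card
  /-- H3: the switching-equivalent graph on `W k` is connected (cut form) -/
  connected : ∀ k, ∀ S ⊆ W k, S.Nonempty → S ≠ W k →
    ∃ a ∈ S, ∃ b ∈ W k \ S, (swGraph G (W k) (col k)).Adj a b
  /-- H4: a vertex present at node `k` and absent at node `k'` is homogeneous to every cell of node `k'` -/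
  removal : ∀ k k', k < k' → ∀ v ∈ W k, v ∉ W k' → ∀ w ∈ W k',
    (∀ y ∈ cellOf (W k') (col k') w, G.Adj v y) ∨ (∀ y ∈ cellOf (W k') (col k') w, ¬ G.Adj v y)
  /-- H5: every transition before the end removes a vertex -/
  progress : ∀ k < N, W (k + 1) ≠ W k

variable {G} {N : ℕ}

namespace RefinementPath

variable (R : RefinementPath G N)

/-- The cell of `u` at node `k`. -/
abbrev cell (k : ℕ) (u : V) : Finset V := cellOf (R.W k) (R.col k) u

/-- The switching-equivalent graph at node `k`. -/
abbrev sw (k : ℕ) : SimpleGraph V := swGraph G (R.W k) (R.col k)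

/-- `u` is REMOVED OR HALVED at the transition `k → k+1`. -/
def Event (k : ℕ) (u : V) : Prop := u ∉ R.W (k + 1) ∨ 2 * (R.cell (k + 1) u).card ≤ (R.cell k u).card

/-- `Event` is decidable. -/
instance (k : ℕ) : DecidablePred (R.Event k) := fun u => by unfold Event; infer_instance

/-- The progress `Δ_k`: number of vertices of `W k` removed or halved at the transition `k → k+1`. -/
def delta (k : ℕ) : ℕ := ((R.W k).filter fun u => R.Event k u).card

/-- A BAD (quiet) step: progress below `d k / 2`. -/
def Bad (k : ℕ) : Prop := 2 * R.delta k < R.d k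

/-- `Bad` is decidable. -/
instance (k : ℕ) : Decidable (R.Bad k) := by unfold Bad; infer_instance


/-- The HUB DATA of a bad step `k`: a halved surviving vertex `z` and a giant vertex `y` joined by a
switching-edge of node `k` (as produced by `exists_hub`). -/
def HubSpec (k : ℕ) (z y : V) : Prop :=
  z ∈ R.W (k + 1) ∧ y ∈ R.W (k + 1) ∧ 2 * (R.cell (k + 1) z).card ≤ (R.cell k z).card ∧
    (R.cell k y).card < 2 * (R.cell (k + 1) y).card ∧ (R.sw k).Adj z y

/-- Bad step `j` is STALE w.r.t. the earlier bad step `k` (for hub choices `y`): its giant lies in the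
giant of `k` and its giant's node-`j` cell is still more than half of the giant of `k`. -/
def Stale (y : ℕ → V) (j k : ℕ) : Prop :=
  k < j ∧ R.cell (j + 1) (y j) ⊆ R.cell (k + 1) (y k) ∧
    (R.cell (k + 1) (y k)).card < 2 * (R.cell j (y j)).card

/-- `Stale` is decidable. -/
instance (y : ℕ → V) (j k : ℕ) : Decidable (R.Stale y j k) := by unfold Stale; infer_instance

end RefinementPath

end BranchSum

end Summit.PneNP.PneNP.Theorems
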